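/-
COR-CM (cell pub-hodgecm2, stage 2 of the Hodge ladder) — Δ2 BRIDGE, WALL-BREAKER 3 ∕ S-e (branch T-ῑ, realisation (c-S.1)): the S1 CURRENCY lemma
at a MIXED presentation ∕ instance.  Seat prover-pub-hodgecm2-d2bridge-wb-3-g0-0.  ONE theorem (kernel lane): no definition, no named fact, no instance,
no section `variable` carrying a named Prop, no `sorry`; nothing landed is edited or restated.  HC_CM is NOT proved; «Δ2 BRIDGE CLOSED» is NOT claimed.
-/
import Summits.HodgeConjecture.CorCM.D2Bridge.HcmS1LiuCMRecord
import Summits.HodgeConjecture.CorCM.D2Bridge.HcmMLine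
import HarnessLib

set_option autoImplicit false

/-!
# Δ2 bridge, S1 currency at a mixed presentation ∕ instance

✔ `baseChange_hOneAlgHom_of_lineModuleOne` (`CorCM/D2Bridge/HcmS1PinJunction.lean`, d2bridge-prove-1) converts the J-record's eigen-law for `α₀`
(`lineModuleOne`: `M_μ = fieldOfValues L μ` acting on `H¹_B(A_μ ⊗ ℂ; ℚ)`) into the S1 core's `hα₀` (`hOneAlgHom` over `muAlgValueField L μ`) — but it is
stated under `letI := ι₁.toAlgebra`, i.e. with the complexifying instance EQUAL to the presentation embedding of the one-object rest.  The re-keyed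
composition (ORIENTATION-MEMO §3.3 T-ῑ; `ConjugateTail.nonempty_hcmPieces_ofTower_of_cmDatum_at`) complexifies the `ιP`-PRESENTED datum along an
ARBITRARY instance (`ιQ = ῑ₁`); both carriers (`lineModuleOne`, `AμC`) are instance-generic (`HcmMLine.lean` §OneObject, `[Algebra E ℂ]`), and so is
the proof (the two value fields have the same elements, `mem_fieldOfValues_iff`; both operators are `(i_{μ,ℂ} k)^*`, `hOneAlgHom_apply`).  This file
states the currency lemma in that generality: `baseChange_hOneAlgHom_of_lineModuleOne_at`.

References: Y. Liu, arXiv:2102.11518 = Camb. J. Math. 9 (2021), §4.1 (`FJcycle.tex` l. 1926–1928), Def. 4.5 (2) (l. 1948), proof of Thm. 4.18 (l. 2250).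
HC_CM is NOT proved.
-/

noncomputable section

open scoped TensorProduct

namespace Summit.HodgeConjecture.CorCM.D2Bridge

open CategoryTheory NumberField
open Literature.AlgebraicGeometry.Motives Literature.AlgebraicGeometry.HodgeTheory
open Literature.AlgebraicGeometry.ComplexMultiplication
open Literature.NumberTheory.ComplexMultiplication Literature.NumberTheory.Automorphic
open Literature.NumberTheory.Automorphic.IdeleClassGroup Literature.NumberTheory.Automorphic.PicardCM
open Literature.NumberTheory.Automorphic.Liu2021 Literature.NumberTheory.Automorphic.Liu2021.AppendixC.RestOne

section CurrencyAt

variable {L : Type} [Field L] [NumberField L] [IsCMField L] [IsGalois ℚ L] (ιP : L →+* ℂ) [Algebra L ℂ]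
  {μ : Literature.NumberTheory.Automorphic.IdeleClassGroup L →ₜ* Circle} (hμ : IsConjugateSymplectic L μ)
  (hw : HasWeight L μ 1) (Car : Def45.Carriers L μ)

/-- **Currency, at ANY complexifying instance.**  At the one-object rest PRESENTED through `ιP` (`D : ObjOne (AlgHom.id ℚ L) ιP …`,
`A_μ ⊗ ℂ = AμC … D` along the AMBIENT `Algebra L ℂ`), an eigen-law for `α₀` in the J-record's currency — `M_μ = fieldOfValues L μ` acting on
`H¹_B(A_μ ⊗ ℂ; ℚ)` through `jOne D` (`lineModuleOne`, `CorCM/D2Bridge/HcmMLine.lean`) — IS the S1 core's `hα₀` over `muAlgValueField L μ` and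
`hOneAlgHom ((· ⊗ ℂ) ∘ i_μ)`: the two value fields have the same elements (`mem_fieldOfValues_iff`) and both operators are `(i_{μ,ℂ} k)^*`
(`hOneAlgHom_apply`).  Same proof as ✔ `baseChange_hOneAlgHom_of_lineModuleOne` (there: instance `= ιP.toAlgebra`).
[cite: Liu2021, §4.1 (FJcycle.tex l. 1926–1928) and proof of Thm. 4.18 (l. 2250)] -/
theorem baseChange_hOneAlgHom_of_lineModuleOne_at (D : ObjOne (AlgHom.id ℚ L) ιP hμ hw Car)
    (α₀ : ℂ ⊗[ℚ] bettiCohomology (AμC (AlgHom.id ℚ L) ιP hμ hw Car D).X 1)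
    (hα₀ : letI := lineModuleOne (AlgHom.id ℚ L) ιP hμ hw Car D
      ∀ s : fieldOfValues L μ,
        (DistribSMul.toLinearMap ℚ (bettiCohomology (AμC (AlgHom.id ℚ L) ιP hμ hw Car D).X 1) s).baseChange ℂ α₀ =
          algebraMap (fieldOfValues L μ) ℂ s • α₀)
    (k : muAlgValueField L μ) :
    haveI := hμ.numberField_muAlgValueField
    (hOneAlgHom ((AbelianVariety.endAlgebra.mapRingHom ((datum (AlgHom.id ℚ L) ιP hμ hw Car D).A.endBaseChange ℂ)).toRingHom.comp
        (datum (AlgHom.id ℚ L) ιP hμ hw Car D).i) k).baseChange ℂ α₀ = ((k : muAlgValueField L μ) : ℂ) • α₀ := by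
  haveI := hμ.numberField_muAlgValueField
  let s : fieldOfValues L μ := ⟨(k : ℂ), (mem_fieldOfValues_iff L μ (k : ℂ)).2 k.2⟩
  have e : (letI := lineModuleOne (AlgHom.id ℚ L) ιP hμ hw Car D
      DistribSMul.toLinearMap ℚ (bettiCohomology (AμC (AlgHom.id ℚ L) ιP hμ hw Car D).X 1) s) =
      hOneAlgHom ((AbelianVariety.endAlgebra.mapRingHom ((datum (AlgHom.id ℚ L) ιP hμ hw Car D).A.endBaseChange ℂ)).toRingHom.comp
        (datum (AlgHom.id ℚ L) ιP hμ hw Car D).i) k := by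
    apply LinearMap.ext
    intro x
    rw [hOneAlgHom_apply]
    rfl
  have h := hα₀ s
  rw [e] at h
  exact h

end CurrencyAt

end Summit.HodgeConjecture.CorCM.D2Bridge

end
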